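import Mathlib
import Literature.Probability.LatticeModels.TemperleyLiebBaxterization
import Literature.Probability.Percolation.DiagonalStripTransferInhomogeneous
import HarnessLib

/-!
# Towards IP12's transfer-matrix recursion (Lemma 3.3): the fusion identity

Topic `Literature/Probability/Percolation`. Ikhlef–Ponsaing (J. Stat. Phys. 149 (2012),
arXiv:1202.5476) Lemma 3.3: `t_L(z_{i+1} = q z_i) ∘ φ_i = φ_i ∘ t_{L-2}(ẑ_i, ẑ_{i+1})`, where
`φ_i` inserts a small link (`Literature/Probability/LatticeModels/TemperleyLiebSmallLink.lean`). In
the cluster language of `DiagonalStripTransferInhomogeneous.lean` the mechanism is local: at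
`z_{i+1} = q z_i` the two tiles incident to the inserted site have open-weights `B(y)` and `A(q y)`
(row `0`, `y = z_i/w`; in row `1` and in the odd-`i` cases the same pair appears through
`1 - A = B`, `1 - B = A`), and

* **`ipWtA_qmul_mul_ipWtB`**: `A(q y) · B(y) = 1` (from `[q² y] = -[q/y]` at `q³ = 1`), mirror
  form `one_sub_ipWtA_mul_one_sub_ipWtB`;
* `fusion_complement_sum`, `fusion_complement_sum'`: the three complementary edge patterns of the
  inserted site — which act identically on the column state (a singleton hanging on one open edge,
  or a site attached to an already joined pair, is invisible) — carry total weight `0`.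

So the pattern that reproduces the small system (both edges open through a singleton = duplication;
both edges closed at a new site = singleton insertion) has weight exactly `1` and everything else
cancels; this is the whole analytic content of Lemma 3.3, the rest being the combinatorics of
`colUpdate` with an inserted site (not in this file).

## References

* Y. Ikhlef, A. K. Ponsaing, J. Stat. Phys. 149 (2012) 10–36, arXiv:1202.5476, Lemma 3.3.
  [IkhlefPonsaing2012]
-/

namespace Literature.Probability.Percolation

open Literature.Probability.LatticeModels

/-! ### The fusion identity `A(q y) · B(y) = 1` -/

section Fusion

open Literature.Probability.LatticeModels.TemperleyLieb

variable {K : Type*} [Field K]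

/-- `[q² y] = -[q/y]` at a primitive cube root of unity. [folklore] -/
theorem qbr_sq_mul_eq {q : K} (hq : q ^ 2 + q + 1 = 0) (y : K) : qbr (q ^ 2 * y) = -qbr (q / y) := by
  have hq0 : q ≠ 0 := by rintro rfl; norm_num at hq
  have hq3 : q ^ 3 = 1 := by linear_combination (q - 1) * hq
  by_cases hy : y = 0
  · subst hy; simp [qbr]
  unfold qbr
  have h1 : q ^ 2 * y = y / q := by
    rw [eq_div_iff hq0]; linear_combination y * hq3
  rw [h1]
  field_simp
  ring

/-- **The fusion identity**: `A(q y) B(y) = 1` (`q² + q + 1 = 0`; the brackets in the denominators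
nonzero). This is the local identity behind IP12's transfer-matrix recursion (Lemma 3.3): at
`z_{i+1} = q z_i` the two tiles around the inserted small link have open-weights `B(y)` and `A(qy)`
(resp. closed-weights `1 - A = B`, `1 - B = A` in the mirror cases), whose product is `1`, while the
three complementary edge patterns act identically and carry total weight `0`.
[cite: IkhlefPonsaing2012, Lemma 3.3] -/
theorem ipWtA_qmul_mul_ipWtB {q y : K} (hq : q ^ 2 + q + 1 = 0) (hy : qbr y ≠ 0) (hqy : qbr (q / y) ≠ 0) :
    ipWtA q (q * y) * ipWtB q y = 1 := by
  have hq0 : q ≠ 0 := by rintro rfl; norm_num at hq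
  have hy0 : y ≠ 0 := by rintro rfl; simp [qbr] at hy
  unfold ipWtA ipWtB
  have h1 : q * (q * y) = q ^ 2 * y := by ring
  have h2 : q / (q * y) = y⁻¹ := by field_simp
  rw [h1, h2, qbr_sq_mul_eq hq, qbr_inv]
  field_simp

/-- The mirror form: `(1 - A(y)) (1 - B(q y)) = 1`. [cite: IkhlefPonsaing2012, Lemma 3.3] -/
theorem one_sub_ipWtA_mul_one_sub_ipWtB {q y : K} (hq : q ^ 2 + q + 1 = 0) (hy : qbr y ≠ 0)
    (hqy : qbr (q / y) ≠ 0) (hqqy : qbr (q / (q * y)) ≠ 0) :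
    (1 - ipWtA q y) * (1 - ipWtB q (q * y)) = 1 := by
  have hA : 1 - ipWtA q y = ipWtB q y := by
    have := ipWtA_add_ipWtB hq hqy; linear_combination -this
  have hB : 1 - ipWtB q (q * y) = ipWtA q (q * y) := by
    have := ipWtA_add_ipWtB hq hqqy; linear_combination -this
  rw [hA, hB, mul_comm]
  exact ipWtA_qmul_mul_ipWtB hq hy hqy

/-- **Cancellation of the three complementary edge patterns** (open-weights `B(y)`, `A(qy)`):
`B(1-A') + (1-B)A' + (1-B)(1-A') = 0`. [cite: IkhlefPonsaing2012, Lemma 3.3] -/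
theorem fusion_complement_sum {q y : K} (hq : q ^ 2 + q + 1 = 0) (hy : qbr y ≠ 0) (hqy : qbr (q / y) ≠ 0) :
    ipWtB q y * (1 - ipWtA q (q * y)) + (1 - ipWtB q y) * ipWtA q (q * y) +
      (1 - ipWtB q y) * (1 - ipWtA q (q * y)) = 0 := by
  have h := ipWtA_qmul_mul_ipWtB hq hy hqy
  linear_combination -h

/-- The mirror cancellation (closed-weights multiply to `1`): `A B' + A(1-B') … ` — with open-weights
`a = A(y)`, `b = B(qy)` and `(1-a)(1-b) = 1`: `ab + a(1-b) + (1-a)b = 0`. [cite: IkhlefPonsaing2012, Lemma 3.3] -/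
theorem fusion_complement_sum' {q y : K} (hq : q ^ 2 + q + 1 = 0) (hy : qbr y ≠ 0)
    (hqy : qbr (q / y) ≠ 0) (hqqy : qbr (q / (q * y)) ≠ 0) :
    ipWtA q y * ipWtB q (q * y) + ipWtA q y * (1 - ipWtB q (q * y)) +
      (1 - ipWtA q y) * ipWtB q (q * y) = 0 := by
  have h := one_sub_ipWtA_mul_one_sub_ipWtB hq hy hqy hqqy
  linear_combination -h

end Fusion

end Literature.Probability.Percolation
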